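import Literature.Geometry.Kaehler.CechDolbeault
import Literature.Geometry.Kaehler.HolomorphicLineBundleCechLeray
import Literature.Geometry.Kaehler.DolbeaultBarFunctionLeibniz
import HarnessLib

/-!
# The twisted Čech–Dolbeault double complex: `Ȟ^q(𝔙, 𝒪(L))` from a `∂̄`-acyclic framed cover (Leray, all degrees)

Layer `Literature/Geometry/Kaehler`. The scalar file `CechDolbeault` proves Leray's theorem
`H^{p,q}_{∂̄}(M) ≅ Ȟ^q(𝔘, Ω^p)` for finite `∂̄`-acyclic covers through the abstract double-complex
theorems `ADoubleComplex.rowColEquiv` / `rowColEquiv_natural`. This file is its TWISTED copy for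
the sheaf `𝒪(L)` of sections of a cocycle line bundle `L` (Voisin I, §4.3, Thm. 4.41 and the proof
of Prop. 4.36 / Cor. 4.38 with coefficients in a holomorphic bundle; Griffiths–Harris pp. 40–45),
on a framed cover `𝔙 = (V_k, frame k)` of `HolomorphicLineBundleCech` (sections over `V_J` read in
the frame of the first index):

* `FramedCover.twistRestrict C J τ` — the restriction map of the sheaf `𝒜^{0,b}(L)` of smooth
  `L`-valued `(0,b)`-forms along a face: multiply by the change of frame `trans J τ` and cut off
  to `V_J` (functorial, `twistRestrict_twistRestrict`); `FramedCover.twistδ` — the twisted Čech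
  differential on `C^a(𝔙, 𝒜^{0,b}(L)) = Π_J A^{0,b}(V_J)` (same carriers `CechPQForms` as the
  scalar complex), `twistδ_twistδ`;
* `FramedCover.twistDolbeault C` — **the twisted Čech–Dolbeault double complex**, vertical
  differential `(-1)^a ∂̄` (the scalar `cechDbar`): it anticommutes with `twistδ` because
  `∂̄(g ω) = g ∂̄ω` for the holomorphic transition functions
  (`dolbeaultBar_fun_smul_apply_of_mdifferentiableOn`);
* `HolomorphicLineBundle.TwForms L b` — the **global smooth `L`-valued `(0,b)`-forms**
  `A^{0,b}(L)` (families `α_i ∈ A^{0,b}(U_i)` with `α_j = g_ij α_i`, Voisin I §4.3.1 before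
  Prop. 4.36) with `∂̄_L` computed framewise (`TwForms.dbar`), and the **row augmentation**
  `twistDolbeaultRow` (restriction to `V_k` in the frame `frame k`); rows are exact by the
  partition-of-unity contraction WITH CHANGE OF FRAME (`twistDolbeault_rowExact`,
  `twistDolbeaultRow_exact`);
* the **column augmentation** `twistDolbeaultCol` by the holomorphic cochains `C^a(𝔙, 𝒪(L))` of
  `HolomorphicLineBundleCech` (a function is the `0`-form `MForm.ofFun`; exact because
  `∂̄`-closed functions are holomorphic, `mdifferentiableOn_of_dolbeaultBar_ofFun_eq_zero`), and
  column exactness from `∂̄`-acyclicity of the `V_J` (`twistDolbeault_colExact`);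
* **`FramedCover.cechDolbeaultEquivL`** — `H^q(A^{0,•}(L), ∂̄_L) ≃ₗ[ℂ] Ȟ^q(𝔙, 𝒪(L))` for a finite
  covering framed cover with `∂̄`-acyclic finite intersections (Hausdorff σ-compact `M`), in EVERY
  degree `q`, and its **naturality under shrinking** `cechDolbeaultEquivL_natural` (restriction
  `Ȟ^q(𝔙, 𝒪(L)) → Ȟ^q(𝔙', 𝒪(L))` is an isomorphism for two such covers `V'_k ⊆ V_k`) — the Leray
  input of the twisted Cartan–Serre finiteness theorem in all degrees (sibling file
  `HolomorphicLineBundleCechFiniteAll`).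

Everything is proved; the definitions are the carriers and maps listed.

## References

* C. Voisin, *Hodge Theory and Complex Algebraic Geometry I* (2002), §4.3.1, Prop. 4.36,
  Cor. 4.38, Thm. 4.41. [VoisinHodgeI2002]
* P. Griffiths, J. Harris, *Principles of Algebraic Geometry* (1978), pp. 40–45.
  [GriffithsHarris1978]
* R. Bott, L. W. Tu, *Differential Forms in Algebraic Topology* (1982), Prop. 8.5, Thm. 8.9.
  [BottTu1982Forms]
-/

noncomputable section

open scoped Manifold ContDiff Topology
open Set Filter Function Literature.Algebra.Homology Literature.NumberTheory.Transcendental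

namespace Literature.Geometry.Kaehler

variable {ι κ : Type*} {E : Type*} [NormedAddCommGroup E] [NormedSpace ℂ E]
  {M : Type*} [TopologicalSpace M] [ChartedSpace E M]

/-! ### Auxiliary: complex functions times local forms -/

/-- A complex function real-`C^∞` at the points of an open `W'`, times a `(p,q)`-form on `W ⊇ W'`,
cut off to `W'`, is a `(p,q)`-form on `W'`. [folklore] -/
theorem fun_smul_restr_mem_pqFormsOn {W W' : Set M} (hW' : IsOpen W') (h : W' ⊆ W) {p q : ℕ}
    {t : M → ℂ} (ht : ∀ x ∈ W', ContMDiffAt 𝓘(ℝ, E) 𝓘(ℝ, ℂ) ∞ t x)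
    {α : MForm 𝓘(ℝ, E) M ℂ (p + q)} (hα : α ∈ pqFormsOn E M W p q) :
    (t • α).restr W' ∈ pqFormsOn E M W' p q := by
  refine ⟨fun x hx ↦ ?_, fun x hx ↦ MForm.restr_apply_of_notMem _ hx, ?_⟩
  · have hs : (t • α).SmoothAt x := (hα.1 x (h hx)).fun_smul_complex (ht x hx)
    exact hs.congr_of_eventuallyEq (by
      filter_upwards [hW'.mem_nhds hx] with y hy
      exact (MForm.restr_apply_of_mem _ hy).symm)
  · exact (IsOfType.cmul t hα.2.2).restr W'

/-- Pointwise value of a cut-off product at a point of the set. [folklore] -/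
theorem fun_smul_restr_apply_of_mem {W' : Set M} {k : ℕ} (t : M → ℂ) (α : MForm 𝓘(ℝ, E) M ℂ k)
    {x : M} (hx : x ∈ W') : ((t • α).restr W') x = t x • α x := by
  rw [MForm.restr_apply_of_mem _ hx, MForm.fun_smul_complex_apply]

namespace HolomorphicLineBundle

/-! ### Global smooth `L`-valued `(0,b)`-forms and `∂̄_L` -/

section TwForms

variable (L : HolomorphicLineBundle ι E M)

/-- **The smooth `L`-valued `(0,b)`-forms `A^{0,b}(L)`**: families `α_i ∈ A^{0,b}(U_i)` of local
forms in the frames `σ_i` with `α_j = g_ij α_i` on `U_i ∩ U_j` (Voisin I, §4.3.1 before Prop. 4.36;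
Huybrechts (2005), Def. 2.6.24 `𝒜^{0,q}(E)`), a `ℂ`-submodule of `ι → MForm`.
[cite: VoisinHodgeI2002, §4.3.1] -/
def TwForms (b : ℕ) : Submodule ℂ (ι → MForm 𝓘(ℝ, E) M ℂ (0 + b)) where
  carrier := {α | (∀ i, α i ∈ pqFormsOn E M (L.baseSet i) 0 b) ∧
    ∀ i j, ∀ x ∈ L.baseSet i ∩ L.baseSet j, α j x = L.coordChange i j x • α i x}
  add_mem' hα hβ := ⟨fun i ↦ Submodule.add_mem _ (hα.1 i) (hβ.1 i), fun i j x hx ↦ by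
    simp only [Pi.add_apply, hα.2 i j x hx, hβ.2 i j x hx, smul_add]⟩
  zero_mem' := ⟨fun i ↦ Submodule.zero_mem _, fun i j x hx ↦ by simp⟩
  smul_mem' c α hα := ⟨fun i ↦ Submodule.smul_mem _ c (hα.1 i), fun i j x hx ↦ by
    simp only [Pi.smul_apply, hα.2 i j x hx, smul_comm c]⟩

variable {L}

/-- Membership in `TwForms`. [folklore] -/
theorem mem_twForms_iff {b : ℕ} {α : ι → MForm 𝓘(ℝ, E) M ℂ (0 + b)} :
    α ∈ L.TwForms b ↔ (∀ i, α i ∈ pqFormsOn E M (L.baseSet i) 0 b) ∧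
      ∀ i j, ∀ x ∈ L.baseSet i ∩ L.baseSet j, α j x = L.coordChange i j x • α i x :=
  Iff.rfl

/-- The `i`-th component of an `L`-valued form as a local form on `U_i`. [folklore] -/
def TwForms.comp {b : ℕ} (α : L.TwForms b) (i : ι) : ↥(pqFormsOn E M (L.baseSet i) 0 b) :=
  ⟨(α : ι → MForm 𝓘(ℝ, E) M ℂ (0 + b)) i, α.2.1 i⟩

/-- Underlying form of a component. [folklore] -/
@[simp]
theorem TwForms.coe_comp {b : ℕ} (α : L.TwForms b) (i : ι) :
    (TwForms.comp α i : MForm 𝓘(ℝ, E) M ℂ (0 + b)) = (α : ι → MForm 𝓘(ℝ, E) M ℂ (0 + b)) i :=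
  rfl

variable [FiniteDimensional ℂ E] [T2Space M] [IsManifold 𝓘(ℂ, E) ω M] [IsManifold 𝓘(ℝ, E) ∞ M]

/-- **`∂̄_L` is well defined**: the framewise `∂̄`'s of an `L`-valued form again transform by the
cocycle, `∂̄ α_j = g_ij ∂̄ α_i` on `U_i ∩ U_j` (`∂̄(g α) = g ∂̄α` for holomorphic `g`, and locality
of `∂̄`; Huybrechts, proof of Prop. 2.6.23). [cite: VoisinHodgeI2002, Prop. 4.36 (proof)] -/
theorem localDbar_comp_glue {b : ℕ} (α : L.TwForms b) (i j : ι) {x : M}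
    (hx : x ∈ L.baseSet i ∩ L.baseSet j) :
    (localDbar E M (L.isOpen_baseSet j) 0 b (TwForms.comp α j) : MForm 𝓘(ℝ, E) M ℂ (0 + (b + 1))) x =
      L.coordChange i j x •
        (localDbar E M (L.isOpen_baseSet i) 0 b (TwForms.comp α i) : MForm 𝓘(ℝ, E) M ℂ (0 + (b + 1))) x := by
  have hW : IsOpen (L.baseSet i ∩ L.baseSet j) := (L.isOpen_baseSet i).inter (L.isOpen_baseSet j)
  rw [localDbar_apply_of_mem _ _ hx.2, localDbar_apply_of_mem _ _ hx.1, TwForms.coe_comp, TwForms.coe_comp]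
  have hev : ∀ᶠ y in 𝓝 x, (α : ι → MForm 𝓘(ℝ, E) M ℂ (0 + b)) j y =
      ((L.coordChange i j) • (α : ι → MForm 𝓘(ℝ, E) M ℂ (0 + b)) i) y := by
    filter_upwards [hW.mem_nhds hx] with y hy
    rw [MForm.fun_smul_complex_apply, α.2.2 i j y hy]
  rw [dolbeaultBar_congr_of_eventuallyEq hev,
    dolbeaultBar_fun_smul_apply_of_mdifferentiableOn hW (L.mdifferentiableOn_coordChange i j)
      (fun z hz ↦ (α.2.1 i).1 z hz.1) hx]

variable (L) in
/-- **The operator `∂̄_L : A^{0,b}(L) → A^{0,b+1}(L)`**, computed framewise.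
[cite: VoisinHodgeI2002, §4.3.1] -/
def TwForms.dbar (b : ℕ) : L.TwForms b →ₗ[ℂ] L.TwForms (b + 1) where
  toFun α := ⟨fun i ↦ (localDbar E M (L.isOpen_baseSet i) 0 b (TwForms.comp α i) : MForm 𝓘(ℝ, E) M ℂ (0 + (b + 1))),
    fun i ↦ (localDbar E M (L.isOpen_baseSet i) 0 b (TwForms.comp α i)).2,
    fun i j x hx ↦ localDbar_comp_glue α i j hx⟩
  map_add' α β := by
    refine Subtype.ext (funext fun i ↦ ?_)
    change (localDbar E M (L.isOpen_baseSet i) 0 b (TwForms.comp (α + β) i) : MForm 𝓘(ℝ, E) M ℂ (0 + (b + 1))) =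
      (localDbar E M (L.isOpen_baseSet i) 0 b (TwForms.comp α i) : MForm 𝓘(ℝ, E) M ℂ (0 + (b + 1))) +
        (localDbar E M (L.isOpen_baseSet i) 0 b (TwForms.comp β i) : MForm 𝓘(ℝ, E) M ℂ (0 + (b + 1)))
    rw [← Submodule.coe_add, ← map_add]
    rfl
  map_smul' c α := by
    refine Subtype.ext (funext fun i ↦ ?_)
    change (localDbar E M (L.isOpen_baseSet i) 0 b (TwForms.comp (c • α) i) : MForm 𝓘(ℝ, E) M ℂ (0 + (b + 1))) =
      c • (localDbar E M (L.isOpen_baseSet i) 0 b (TwForms.comp α i) : MForm 𝓘(ℝ, E) M ℂ (0 + (b + 1)))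
    rw [← Submodule.coe_smul, ← map_smul]
    rfl

/-- The components of `∂̄_L α` (definitional). [folklore] -/
theorem TwForms.dbar_apply {b : ℕ} (α : L.TwForms b) (i : ι) :
    (TwForms.dbar L b α : ι → MForm 𝓘(ℝ, E) M ℂ (0 + (b + 1))) i =
      (localDbar E M (L.isOpen_baseSet i) 0 b (TwForms.comp α i) : MForm 𝓘(ℝ, E) M ℂ (0 + (b + 1))) :=
  rfl

/-- The components of `∂̄_L α` as local forms (definitional). [folklore] -/
theorem TwForms.comp_dbar {b : ℕ} (α : L.TwForms b) (i : ι) :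
    TwForms.comp (TwForms.dbar L b α) i = localDbar E M (L.isOpen_baseSet i) 0 b (TwForms.comp α i) :=
  rfl

end TwForms

namespace FramedCover

variable {L : HolomorphicLineBundle ι E M} (C : L.FramedCover κ)

/-! ### The twisted Čech differential on form-valued cochains -/

section Twist

variable [FiniteDimensional ℂ E] [IsManifold 𝓘(ℝ, E) ∞ M] [IsManifold 𝓘(ℂ, E) ω M]

/-- The change of frame along a face is real-`C^∞` at the points of `V_J`. [folklore] -/
theorem contMDiffAt_trans {m n : ℕ} (J : Fin (n + 1) → κ) (τ : Fin (m + 1) → Fin (n + 1)) {x : M}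
    (hx : x ∈ cechSet C.U J) : ContMDiffAt 𝓘(ℝ, E) 𝓘(ℝ, ℂ) ∞ (C.trans J τ) x :=
  contMDiffAt_real_of_mdifferentiableOn_complex (C.mdifferentiableOn_trans J τ)
    (isOpen_cechSet C.isOpen J) hx

/-- **The restriction map of `𝒜^{0,b}(L)` along a face** `τ`: multiply by the change of frame
`trans J τ` and cut off to `V_J` (the form-valued analogue of `FramedCover.face`).
[cite: VoisinHodgeI2002, §4.3.1] -/
def twistRestrict {m n : ℕ} (J : Fin (n + 1) → κ) (τ : Fin (m + 1) → Fin (n + 1)) (b : ℕ) :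
    ↥(pqFormsOn E M (cechSet C.U (J ∘ τ)) 0 b) →ₗ[ℂ] ↥(pqFormsOn E M (cechSet C.U J) 0 b) where
  toFun α := ⟨((C.trans J τ) • (α : MForm 𝓘(ℝ, E) M ℂ (0 + b))).restr (cechSet C.U J),
    fun_smul_restr_mem_pqFormsOn (isOpen_cechSet C.isOpen J) (cechSet_subset_comp C.U J τ)
      (fun _ hx ↦ C.contMDiffAt_trans J τ hx) α.2⟩
  map_add' α β := by
    refine Subtype.ext (funext fun x ↦ ?_)
    by_cases hx : x ∈ cechSet C.U J
    · simp only [Submodule.coe_add, Pi.add_apply, MForm.restr_apply_of_mem _ hx,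
        MForm.fun_smul_complex_apply, smul_add]
    · simp only [Submodule.coe_add, Pi.add_apply, MForm.restr_apply_of_notMem _ hx, add_zero]
  map_smul' c α := by
    refine Subtype.ext (funext fun x ↦ ?_)
    by_cases hx : x ∈ cechSet C.U J
    · simp only [Submodule.coe_smul, Pi.smul_apply, MForm.restr_apply_of_mem _ hx,
        MForm.fun_smul_complex_apply, RingHom.id_apply]
      exact smul_comm _ _ _
    · simp only [Submodule.coe_smul, Pi.smul_apply, MForm.restr_apply_of_notMem _ hx,
        RingHom.id_apply, smul_zero]

/-- The twisted restriction at a point of `V_J`. [folklore] -/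
theorem twistRestrict_apply_of_mem {m n : ℕ} (J : Fin (n + 1) → κ) (τ : Fin (m + 1) → Fin (n + 1))
    {b : ℕ} (α : ↥(pqFormsOn E M (cechSet C.U (J ∘ τ)) 0 b)) {x : M} (hx : x ∈ cechSet C.U J) :
    (C.twistRestrict J τ b α : MForm 𝓘(ℝ, E) M ℂ (0 + b)) x =
      C.trans J τ x • (α : MForm 𝓘(ℝ, E) M ℂ (0 + b)) x :=
  fun_smul_restr_apply_of_mem _ _ hx

/-- The twisted restriction off `V_J`. [folklore] -/
theorem twistRestrict_apply_of_notMem {m n : ℕ} (J : Fin (n + 1) → κ) (τ : Fin (m + 1) → Fin (n + 1))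
    {b : ℕ} (α : ↥(pqFormsOn E M (cechSet C.U (J ∘ τ)) 0 b)) {x : M} (hx : x ∉ cechSet C.U J) :
    (C.twistRestrict J τ b α : MForm 𝓘(ℝ, E) M ℂ (0 + b)) x = 0 :=
  MForm.restr_apply_of_notMem _ hx

/-- **Functoriality of the twisted restrictions** (presheaf `𝒜^{0,b}(L)` on the nerve; the cocycle
condition `trans_mul_trans`). [cite: VoisinHodgeI2002, §4.3.1] -/
theorem twistRestrict_twistRestrict {l m n : ℕ} (J : Fin (n + 1) → κ) (τ : Fin (m + 1) → Fin (n + 1))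
    (τ' : Fin (l + 1) → Fin (m + 1)) {b : ℕ} (α : ↥(pqFormsOn E M (cechSet C.U (J ∘ τ ∘ τ')) 0 b)) :
    C.twistRestrict J τ b (C.twistRestrict (J ∘ τ) τ' b α) = C.twistRestrict J (τ ∘ τ') b α := by
  refine Subtype.ext (funext fun x ↦ ?_)
  by_cases hx : x ∈ cechSet C.U J
  · rw [C.twistRestrict_apply_of_mem J τ _ hx, C.twistRestrict_apply_of_mem J (τ ∘ τ') _ hx,
      C.twistRestrict_apply_of_mem (J ∘ τ) τ' _ (cechSet_subset_comp C.U J τ hx), smul_smul,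
      C.trans_mul_trans J τ τ' hx]
  · rw [C.twistRestrict_apply_of_notMem J τ _ hx, C.twistRestrict_apply_of_notMem J (τ ∘ τ') _ hx]

/-- **The twisted Čech differential on `C^a(𝔙, 𝒜^{0,b}(L))`**,
`(δ ω)_J = Σ_j (-1)^j g_{J,σ_j} ω_{J ∘ σ_j}|_{V_J}`. [cite: VoisinHodgeI2002, §4.3.1] -/
def twistδ (a b : ℕ) : CechPQForms E M C.U 0 a b →ₗ[ℂ] CechPQForms E M C.U 0 (a + 1) b where
  toFun c J := ∑ j : Fin (a + 2), (-1 : ℂ) ^ (j : ℕ) • C.twistRestrict J (Fin.succAbove j) b (c (J ∘ Fin.succAbove j))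
  map_add' c c' := by
    funext J
    simp only [Pi.add_apply, map_add, smul_add, Finset.sum_add_distrib]
  map_smul' r c := by
    funext J
    simp only [Pi.smul_apply, map_smul, RingHom.id_apply, Finset.smul_sum, smul_smul, mul_comm r]

/-- The twisted Čech differential, componentwise. [cite: VoisinHodgeI2002, §4.3.1] -/
theorem twistδ_apply {a b : ℕ} (c : CechPQForms E M C.U 0 a b) (J : Fin (a + 2) → κ) :
    C.twistδ a b c J = ∑ j : Fin (a + 2), (-1 : ℂ) ^ (j : ℕ) •
      C.twistRestrict J (Fin.succAbove j) b (c (J ∘ Fin.succAbove j)) :=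
  rfl

/-- The twisted Čech differential at a point of `V_J`. [folklore] -/
theorem coe_twistδ_apply_apply_of_mem {a b : ℕ} (c : CechPQForms E M C.U 0 a b) {J : Fin (a + 2) → κ}
    {y : M} (hy : y ∈ cechSet C.U J) :
    (C.twistδ a b c J : MForm 𝓘(ℝ, E) M ℂ (0 + b)) y = ∑ j : Fin (a + 2), (-1 : ℂ) ^ (j : ℕ) •
      (C.trans J (Fin.succAbove j) y • (c (J ∘ Fin.succAbove j) : MForm 𝓘(ℝ, E) M ℂ (0 + b)) y) := by
  rw [twistδ_apply, Submodule.coe_sum, Finset.sum_apply]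
  refine Finset.sum_congr rfl fun j _ ↦ ?_
  rw [Submodule.coe_smul, Pi.smul_apply, C.twistRestrict_apply_of_mem J _ _ hy]

/-- The twisted Čech differential off `V_J`. [folklore] -/
theorem coe_twistδ_apply_apply_of_notMem {a b : ℕ} (c : CechPQForms E M C.U 0 a b) {J : Fin (a + 2) → κ}
    {y : M} (hy : y ∉ cechSet C.U J) : (C.twistδ a b c J : MForm 𝓘(ℝ, E) M ℂ (0 + b)) y = 0 :=
  (C.twistδ a b c J).2.2.1 y hy

/-- **`δ ∘ δ = 0`** for the twisted Čech differential on forms. [cite: VoisinHodgeI2002, §4.3.1] -/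
theorem twistδ_twistδ (a b : ℕ) (c : CechPQForms E M C.U 0 a b) : C.twistδ (a + 1) b (C.twistδ a b c) = 0 := by
  funext J
  rw [twistδ_apply, Pi.zero_apply]
  simp only [twistδ_apply, map_sum, map_smul, twistRestrict_twistRestrict, Finset.smul_sum]
  exact CechTuple.sum_sum_neg_one_pow_smul_smul_faces_eq_zero (R := ℂ)
    (fun θ ↦ C.twistRestrict J θ b (c (J ∘ θ)))

variable [T2Space M]

/-- **`∂̄` commutes with the twisted restrictions** (`∂̄(g ω) = g ∂̄ω` for the holomorphic change
of frame, and locality of `∂̄`). [cite: VoisinHodgeI2002, Prop. 4.36 (proof)] -/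
theorem localDbar_twistRestrict {m n : ℕ} (J : Fin (n + 1) → κ) (τ : Fin (m + 1) → Fin (n + 1))
    {b : ℕ} (α : ↥(pqFormsOn E M (cechSet C.U (J ∘ τ)) 0 b)) :
    localDbar E M (isOpen_cechSet C.isOpen J) 0 b (C.twistRestrict J τ b α) =
      C.twistRestrict J τ (b + 1) (localDbar E M (isOpen_cechSet C.isOpen (J ∘ τ)) 0 b α) := by
  refine Subtype.ext (funext fun x ↦ ?_)
  by_cases hx : x ∈ cechSet C.U J
  · rw [localDbar_apply_of_mem _ _ hx, C.twistRestrict_apply_of_mem J τ _ hx, localDbar_apply_of_mem _ _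
      (cechSet_subset_comp C.U J τ hx)]
    change dolbeaultBar (((C.trans J τ) • (α : MForm 𝓘(ℝ, E) M ℂ (0 + b))).restr (cechSet C.U J)) x = _
    rw [dolbeaultBar_restr_apply_of_mem (isOpen_cechSet C.isOpen J) _ hx,
      dolbeaultBar_fun_smul_apply_of_mdifferentiableOn (isOpen_cechSet C.isOpen J)
        (C.mdifferentiableOn_trans J τ) (fun z hz ↦ α.2.1 z (cechSet_subset_comp C.U J τ hz)) hx]
  · rw [C.twistRestrict_apply_of_notMem J τ _ hx]
    exact (localDbar E M (isOpen_cechSet C.isOpen J) 0 b _).2.2.1 x hx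

/-- **The twisted Čech–Dolbeault double complex** `C^a(𝔙, 𝒜^{0,b}(L))`: horizontal `twistδ`,
vertical `(-1)^a ∂̄` (the scalar `cechDbar`), anticommuting. Voisin I, proof of Prop. 4.36 /
Thm. 4.41 with coefficients; Griffiths–Harris p. 44. [cite: VoisinHodgeI2002, Thm. 4.41] -/
def twistDolbeault : ADoubleComplex ℂ (CechPQForms E M C.U 0) where
  d a b := cechDbar E M C.isOpen 0 a b
  δ a b := C.twistδ a b
  d_d a b c := by
    funext J
    rw [cechDbar_apply, cechDbar_apply, map_smul, localDbar_localDbar, smul_zero, smul_zero]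
    rfl
  δ_δ a b c := C.twistδ_twistδ a b c
  anticomm a b c := by
    funext J
    rw [Pi.add_apply, Pi.zero_apply, twistδ_apply, cechDbar_apply, twistδ_apply, map_sum, Finset.smul_sum,
      ← Finset.sum_add_distrib]
    refine Finset.sum_eq_zero fun j _ ↦ ?_
    rw [cechDbar_apply, map_smul, map_smul, C.localDbar_twistRestrict, smul_smul, smul_smul, ← add_smul,
      show (-1 : ℂ) ^ (j : ℕ) * (-1) ^ a + (-1) ^ (a + 1) * (-1) ^ (j : ℕ) = 0 by ring, zero_smul]

end Twist

/-! ### The cocycle conditions of the twisted differential at a point -/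

section Cocycle

variable [FiniteDimensional ℂ E] [IsManifold 𝓘(ℝ, E) ∞ M] [IsManifold 𝓘(ℂ, E) ω M]

omit [FiniteDimensional ℂ E] [IsManifold 𝓘(ℝ, E) ∞ M] [IsManifold 𝓘(ℂ, E) ω M] in
/-- `g_{frame i, frame k} g_{frame k, frame i} = 1` at a point of `V_i ∩ V_k`-type overlaps
(cocycle condition and `g_ii = 1`). [folklore] -/
theorem coordChange_mul_coordChange_symm {i k : ι} {y : M} (hi : y ∈ L.baseSet i) (hk : y ∈ L.baseSet k) :
    L.coordChange i k y * L.coordChange k i y = 1 := by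
  rw [L.coordChange_comp i k i y ⟨⟨hi, hk⟩, hi⟩, L.coordChange_self _ hi]

/-- **The cocycle identity behind the twisted contraction**: if `δ ω = 0` then on `V_i ∩ V_T`,
`ω_T = g_{frame i, frame T₀} Σ_j (-1)^j ω_{(i, T ∘ σ_j)}` (the `0`-th face of `(i, T)` is `T` and
carries the change of frame `g_{frame T₀, frame i}`). [cite: BottTu1982Forms, Prop. 8.5] -/
theorem apply_eq_smul_sum_of_twistδ_eq_zero {a b : ℕ} {c : CechPQForms E M C.U 0 (a + 1) b}
    (hc : C.twistδ (a + 1) b c = 0) (T : Fin (a + 2) → κ) (i : κ) {y : M} (hyi : y ∈ C.U i)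
    (hy : y ∈ cechSet C.U T) :
    (c T : MForm 𝓘(ℝ, E) M ℂ (0 + b)) y = L.coordChange (C.frame i) (C.frame (T 0)) y •
      ∑ j : Fin (a + 2), (-1 : ℂ) ^ (j : ℕ) •
        (c (Fin.cons i (T ∘ Fin.succAbove j) : Fin (a + 2) → κ) : MForm 𝓘(ℝ, E) M ℂ (0 + b)) y := by
  have hyc : y ∈ cechSet C.U (Fin.cons i T : Fin (a + 3) → κ) := by
    rw [cechSet_cons]
    exact ⟨hyi, hy⟩
  have h0 : (C.twistδ (a + 1) b c (Fin.cons i T : Fin (a + 3) → κ) : MForm 𝓘(ℝ, E) M ℂ (0 + b)) y = 0 := by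
    rw [hc]
    rfl
  rw [C.coe_twistδ_apply_apply_of_mem _ hyc, Fin.sum_univ_succ] at h0
  -- the `0`-th face: `T`, with the change of frame `g_{frame T 0, frame i}`
  have e0 : ((Fin.cons i T : Fin (a + 3) → κ) ∘ Fin.succAbove 0) = T := CechTuple.cons_comp_succAbove_zero i T
  have ht0 : C.trans (Fin.cons i T : Fin (a + 3) → κ) (Fin.succAbove 0) y =
      L.coordChange (C.frame (T 0)) (C.frame i) y := by
    change L.coordChange (C.frame ((Fin.cons i T : Fin (a + 3) → κ) (Fin.succAbove 0 0)))
      (C.frame ((Fin.cons i T : Fin (a + 3) → κ) 0)) y = _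
    simp
  have hterm0 : C.trans (Fin.cons i T : Fin (a + 3) → κ) (Fin.succAbove 0) y •
      (c ((Fin.cons i T : Fin (a + 3) → κ) ∘ Fin.succAbove 0) : MForm 𝓘(ℝ, E) M ℂ (0 + b)) y =
      L.coordChange (C.frame (T 0)) (C.frame i) y • (c T : MForm 𝓘(ℝ, E) M ℂ (0 + b)) y := by
    rw [ht0]
    exact congrArg (fun S : Fin (a + 2) → κ ↦ L.coordChange (C.frame (T 0)) (C.frame i) y •
      (c S : MForm 𝓘(ℝ, E) M ℂ (0 + b)) y) e0
  -- the other faces: `(i, T ∘ σ_j)`, change of frame `1`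
  have hterms : ∀ j : Fin (a + 2), C.trans (Fin.cons i T : Fin (a + 3) → κ) (Fin.succAbove j.succ) y •
      (c ((Fin.cons i T : Fin (a + 3) → κ) ∘ Fin.succAbove j.succ) : MForm 𝓘(ℝ, E) M ℂ (0 + b)) y =
      (c (Fin.cons i (T ∘ Fin.succAbove j) : Fin (a + 2) → κ) : MForm 𝓘(ℝ, E) M ℂ (0 + b)) y := by
    intro j
    rw [C.trans_eq_one _ (Fin.succAbove_ne_zero_zero (Fin.succ_ne_zero j)) hyc, one_smul]
    exact congrArg (fun S : Fin (a + 2) → κ ↦ (c S : MForm 𝓘(ℝ, E) M ℂ (0 + b)) y)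
      (CechTuple.cons_comp_succAbove_succ i T j)
  simp only [Fin.val_zero, pow_zero, one_smul, hterm0, Fin.val_succ, hterms] at h0
  -- `h0 : g_{T0,i} ω_T + Σ_j (-1)^{j+1} ω_{(i, T ∘ σ_j)} = 0`
  have h1 : L.coordChange (C.frame (T 0)) (C.frame i) y • (c T : MForm 𝓘(ℝ, E) M ℂ (0 + b)) y =
      ∑ j : Fin (a + 2), (-1 : ℂ) ^ (j : ℕ) •
        (c (Fin.cons i (T ∘ Fin.succAbove j) : Fin (a + 2) → κ) : MForm 𝓘(ℝ, E) M ℂ (0 + b)) y := by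
    rw [add_eq_zero_iff_eq_neg] at h0
    rw [h0, ← Finset.sum_neg_distrib]
    refine Finset.sum_congr rfl fun j _ ↦ ?_
    rw [pow_succ, mul_neg_one, neg_smul, neg_neg]
  have hb0 : y ∈ L.baseSet (C.frame (T 0)) := C.cechSet_subset_baseSet T 0 hy
  have hbi : y ∈ L.baseSet (C.frame i) := C.subset i hyi
  rw [← h1, smul_smul, coordChange_mul_coordChange_symm hbi hb0, one_smul]

/-- **The cocycle condition of a `0`-cochain of forms**: if `δ ω = 0` then
`ω_{(m)} = g_{frame k, frame m} ω_{(k)}` on `V_m ∩ V_k`. [cite: VoisinHodgeI2002, §4.3.1] -/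
theorem apply_eq_smul_of_twistδ_zero_eq_zero {b : ℕ} {c : CechPQForms E M C.U 0 0 b}
    (hc : C.twistδ 0 b c = 0) (m k : κ) {y : M} (hym : y ∈ C.U m) (hyk : y ∈ C.U k) :
    (c (fun _ ↦ m) : MForm 𝓘(ℝ, E) M ℂ (0 + b)) y =
      L.coordChange (C.frame k) (C.frame m) y • (c (fun _ ↦ k) : MForm 𝓘(ℝ, E) M ℂ (0 + b)) y := by
  have hyc : y ∈ cechSet C.U ![m, k] := by
    rw [mem_cechSet_iff, Fin.forall_fin_two]
    exact ⟨hym, hyk⟩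
  have h0 : (C.twistδ 0 b c ![m, k] : MForm 𝓘(ℝ, E) M ℂ (0 + b)) y = 0 := by
    rw [hc]
    rfl
  have e0 : ((![m, k] : Fin 2 → κ) ∘ Fin.succAbove 0) = fun _ ↦ k := by
    funext i; fin_cases i; rfl
  have e1 : ((![m, k] : Fin 2 → κ) ∘ Fin.succAbove 1) = fun _ ↦ m := by
    funext i; fin_cases i; rfl
  have ht0 : C.trans ![m, k] (Fin.succAbove (0 : Fin 2)) y = L.coordChange (C.frame k) (C.frame m) y := by
    unfold trans
    simp
  have ht1 : C.trans ![m, k] (Fin.succAbove (1 : Fin 2)) y = 1 :=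
    C.trans_eq_one _ (Fin.succAbove_ne_zero_zero one_ne_zero) hyc
  have f0 := congrArg (fun S : Fin 1 → κ ↦ (c S : MForm 𝓘(ℝ, E) M ℂ (0 + b)) y) e0
  have f1 := congrArg (fun S : Fin 1 → κ ↦ (c S : MForm 𝓘(ℝ, E) M ℂ (0 + b)) y) e1
  beta_reduce at f0 f1
  rw [C.coe_twistδ_apply_apply_of_mem c hyc, Fin.sum_univ_two, Fin.val_zero, pow_zero, one_smul,
    Fin.val_one, pow_one, neg_one_smul, ht0, ht1, one_smul, f0, f1, add_neg_eq_zero] at h0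
  exact h0.symm

end Cocycle

/-! ### Exactness of the rows: the contraction with change of frame -/

section Rows

variable [FiniteDimensional ℂ E] [IsManifold 𝓘(ℝ, E) ∞ M] [IsManifold 𝓘(ℂ, E) ω M]
  [Fintype κ] (ρ : SmoothPartitionOfUnity κ 𝓘(ℝ, E) M univ) (hρ : ρ.IsSubordinate C.U)

/-- A holomorphic function times a form on `W`, cut off to an open `W' ⊆ W` on which the function
is holomorphic, is a form on `W'` (`smoothFormsOn`). [folklore] -/
theorem fun_smul_restr_mem_smoothFormsOn {W W' : Set M} (hW' : IsOpen W') (h : W' ⊆ W) {k : ℕ}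
    {g : M → ℂ} (hg : MDifferentiableOn 𝓘(ℂ, E) 𝓘(ℂ, ℂ) g W')
    {α : MForm 𝓘(ℝ, E) M ℂ k} (hα : α ∈ smoothFormsOn 𝓘(ℝ, E) ℂ W k) :
    (g • α).restr W' ∈ smoothFormsOn 𝓘(ℝ, E) ℂ W' k := by
  refine ⟨fun x hx ↦ ?_, fun x hx ↦ MForm.restr_apply_of_notMem _ hx⟩
  have hs : (g • α).SmoothAt x :=
    (hα.1 x (h hx)).fun_smul_complex (contMDiffAt_real_of_mdifferentiableOn_complex hg hW' hx)
  exact hs.congr_of_eventuallyEq (by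
    filter_upwards [hW'.mem_nhds hx] with y hy
    exact (MForm.restr_apply_of_mem _ hy).symm)

omit [Fintype κ] in
include hρ in
/-- The terms `ρ_i · g_{frame i, frame J₀} · ω_{(i, J)}` of the twisted contraction are
`(0,b)`-forms on `V_J`. [cite: BottTu1982Forms, Prop. 8.5] -/
theorem smul_twist_cons_mem_pqFormsOn {a b : ℕ} (c : CechPQForms E M C.U 0 (a + 1) b)
    (J : Fin (a + 1) → κ) (i : κ) :
    (ρ i : M → ℝ) • ((L.coordChange (C.frame i) (C.frame (J 0))) •
      (c (Fin.cons i J : Fin (a + 2) → κ) : MForm 𝓘(ℝ, E) M ℂ (0 + b))).restr (cechSet C.U J) ∈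
      pqFormsOn E M (cechSet C.U J) 0 b := by
  have hsub : C.U i ∩ cechSet C.U J ⊆ cechSet C.U (Fin.cons i J : Fin (a + 2) → κ) := by
    rw [cechSet_cons]
  have hg : MDifferentiableOn 𝓘(ℂ, E) 𝓘(ℂ, ℂ) (L.coordChange (C.frame i) (C.frame (J 0)))
      (C.U i ∩ cechSet C.U J) :=
    (L.mdifferentiableOn_coordChange (C.frame i) (C.frame (J 0))).mono fun x hx ↦
      Set.mem_inter (C.subset i hx.1) (C.cechSet_subset_baseSet J 0 hx.2)
  have h1 : ((L.coordChange (C.frame i) (C.frame (J 0))) •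
      (c (Fin.cons i J : Fin (a + 2) → κ) : MForm 𝓘(ℝ, E) M ℂ (0 + b))).restr (C.U i ∩ cechSet C.U J) ∈
      smoothFormsOn 𝓘(ℝ, E) ℂ (C.U i ∩ cechSet C.U J) (0 + b) :=
    fun_smul_restr_mem_smoothFormsOn ((C.isOpen i).inter (isOpen_cechSet C.isOpen J)) hsub hg
      (mem_smoothFormsOn_of_mem_pqFormsOn (c _).2)
  -- the cut-off to `U_i ∩ V_J` equals the cut-off to `V_J` (the form vanishes off `U_i`)
  have heq : ((L.coordChange (C.frame i) (C.frame (J 0))) •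
      (c (Fin.cons i J : Fin (a + 2) → κ) : MForm 𝓘(ℝ, E) M ℂ (0 + b))).restr (C.U i ∩ cechSet C.U J) =
      ((L.coordChange (C.frame i) (C.frame (J 0))) •
        (c (Fin.cons i J : Fin (a + 2) → κ) : MForm 𝓘(ℝ, E) M ℂ (0 + b))).restr (cechSet C.U J) := by
    funext x
    by_cases hx : x ∈ cechSet C.U J
    · by_cases hxi : x ∈ C.U i
      · rw [MForm.restr_apply_of_mem _ (Set.mem_inter hxi hx), MForm.restr_apply_of_mem _ hx]
      · have h0 : (c (Fin.cons i J : Fin (a + 2) → κ) : MForm 𝓘(ℝ, E) M ℂ (0 + b)) x = 0 :=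
          (c _).2.2.1 x fun h ↦ hxi ((cechSet_cons C.U i J).subset h).1
        rw [MForm.restr_apply_of_notMem _ fun h ↦ hxi h.1, MForm.restr_apply_of_mem _ hx,
          MForm.fun_smul_complex_apply, h0, smul_zero]
    · rw [MForm.restr_apply_of_notMem _ fun h ↦ hx h.2, MForm.restr_apply_of_notMem _ hx]
  rw [← heq]
  have h := fun_smul_mem_smoothFormsOn_of_tsupport_subset (ρ i).contMDiff (hρ i) (W := cechSet C.U J) h1
  exact ⟨h.1, h.2, (((c _).2.2.2.cmul _).restr _).fun_smul _⟩

include hρ in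
/-- The twisted contraction `(K ω)_J = Σ_i ρ_i g_{frame i, frame J₀} ω_{(i, J)}` lands in
`A^{0,b}(V_J)`. [cite: BottTu1982Forms, Prop. 8.5] -/
theorem sum_smul_twist_cons_mem_pqFormsOn {a b : ℕ} (c : CechPQForms E M C.U 0 (a + 1) b)
    (J : Fin (a + 1) → κ) :
    ∑ i, (ρ i : M → ℝ) • ((L.coordChange (C.frame i) (C.frame (J 0))) •
      (c (Fin.cons i J : Fin (a + 2) → κ) : MForm 𝓘(ℝ, E) M ℂ (0 + b))).restr (cechSet C.U J) ∈
      pqFormsOn E M (cechSet C.U J) 0 b :=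
  Submodule.sum_mem _ fun i _ ↦ C.smul_twist_cons_mem_pqFormsOn ρ hρ c J i

variable [T2Space M]

include hρ in
/-- **Exactness of the twisted Čech rows in positive columns**: if `δ ω = 0` then `ω = δ (K ω)`
for the contraction with change of frame (Bott–Tu, Prop. 8.5; Voisin I, Prop. 4.36 proof: fine
sheaves are acyclic). [cite: BottTu1982Forms, Prop. 8.5] -/
theorem twistDolbeault_rowExact : (C.twistDolbeault).RowExact := by
  refine ⟨fun a b c hc ↦ ?_⟩
  refine ⟨fun J ↦ ⟨∑ i, (ρ i : M → ℝ) • ((L.coordChange (C.frame i) (C.frame (J 0))) •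
    (c (Fin.cons i J : Fin (a + 2) → κ) : MForm 𝓘(ℝ, E) M ℂ (0 + b))).restr (cechSet C.U J),
    C.sum_smul_twist_cons_mem_pqFormsOn ρ hρ c J⟩, ?_⟩
  funext T
  apply Subtype.ext
  change (C.twistδ a b _ T : MForm 𝓘(ℝ, E) M ℂ (0 + b)) = (c T : MForm 𝓘(ℝ, E) M ℂ (0 + b))
  funext y
  by_cases hy : y ∈ cechSet C.U T
  swap
  · rw [(c T).2.2.1 y hy]
    exact (C.twistδ a b _ T).2.2.1 y hy
  rw [C.coe_twistδ_apply_apply_of_mem _ hy]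
  -- the value of the contraction at `y` on the face `T ∘ σ_j`
  have hK : ∀ j : Fin (a + 2),
      ((⟨∑ i, (ρ i : M → ℝ) • ((L.coordChange (C.frame i) (C.frame ((T ∘ Fin.succAbove j) 0))) •
        (c (Fin.cons i (T ∘ Fin.succAbove j) : Fin (a + 2) → κ) : MForm 𝓘(ℝ, E) M ℂ (0 + b))).restr
          (cechSet C.U (T ∘ Fin.succAbove j)), C.sum_smul_twist_cons_mem_pqFormsOn ρ hρ c _⟩ :
            ↥(pqFormsOn E M (cechSet C.U (T ∘ Fin.succAbove j)) 0 b)) : MForm 𝓘(ℝ, E) M ℂ (0 + b)) y =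
        ∑ i, ((ρ i y : ℝ) : ℂ) • (L.coordChange (C.frame i) (C.frame (T (Fin.succAbove j 0))) y •
          (c (Fin.cons i (T ∘ Fin.succAbove j) : Fin (a + 2) → κ) : MForm 𝓘(ℝ, E) M ℂ (0 + b)) y) := by
    intro j
    have hyj : y ∈ cechSet C.U (T ∘ Fin.succAbove j) := cechSet_subset_comp C.U T _ hy
    change (∑ i, (ρ i : M → ℝ) • ((L.coordChange (C.frame i) (C.frame ((T ∘ Fin.succAbove j) 0))) •
        (c (Fin.cons i (T ∘ Fin.succAbove j) : Fin (a + 2) → κ) : MForm 𝓘(ℝ, E) M ℂ (0 + b))).restr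
          (cechSet C.U (T ∘ Fin.succAbove j))) y = _
    rw [Finset.sum_apply]
    refine Finset.sum_congr rfl fun i _ ↦ ?_
    rw [Pi.smul_apply', fun_smul_restr_apply_of_mem _ _ hyj, Complex.coe_smul]
    rfl
  -- the change of frame along `σ_j` composed with `g_{i, T(σ_j 0)}` is `g_{i, T 0}` on `V_i ∩ V_T`
  have hfac : ∀ i, y ∈ C.U i → ∀ j : Fin (a + 2),
      C.trans T (Fin.succAbove j) y * L.coordChange (C.frame i) (C.frame (T (Fin.succAbove j 0))) y =
        L.coordChange (C.frame i) (C.frame (T 0)) y := by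
    intro i hyi j
    rw [mul_comm]
    exact L.coordChange_comp _ _ _ y ⟨⟨C.subset i hyi, C.cechSet_subset_baseSet T _ hy⟩,
      C.cechSet_subset_baseSet T 0 hy⟩
  calc ∑ j : Fin (a + 2), (-1 : ℂ) ^ (j : ℕ) • (C.trans T (Fin.succAbove j) y • _)
      = ∑ j : Fin (a + 2), ∑ i, (-1 : ℂ) ^ (j : ℕ) • (((ρ i y : ℝ) : ℂ) •
          ((C.trans T (Fin.succAbove j) y * L.coordChange (C.frame i) (C.frame (T (Fin.succAbove j 0))) y) •
            (c (Fin.cons i (T ∘ Fin.succAbove j) : Fin (a + 2) → κ) : MForm 𝓘(ℝ, E) M ℂ (0 + b)) y)) := by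
        refine Finset.sum_congr rfl fun j _ ↦ ?_
        rw [hK j, Finset.smul_sum, Finset.smul_sum]
        refine Finset.sum_congr rfl fun i _ ↦ ?_
        simp only [smul_smul]
        congr 1
        ring
    _ = ∑ i, ((ρ i y : ℝ) : ℂ) • (c T : MForm 𝓘(ℝ, E) M ℂ (0 + b)) y := by
        rw [Finset.sum_comm]
        refine Finset.sum_congr rfl fun i _ ↦ ?_
        by_cases hyi : y ∈ C.U i
        · rw [C.apply_eq_smul_sum_of_twistδ_eq_zero hc T i hyi hy, Finset.smul_sum, Finset.smul_sum]
          refine Finset.sum_congr rfl fun j _ ↦ ?_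
          rw [hfac i hyi j]
          simp only [smul_smul]
          congr 1
          ring
        · simp only [rho_apply_eq_zero ρ hρ hyi, Complex.ofReal_zero, zero_smul, smul_zero,
            Finset.sum_const_zero]
    _ = (c T : MForm 𝓘(ℝ, E) M ℂ (0 + b)) y := by
        rw [← Finset.sum_smul, ← Complex.ofReal_sum, sum_rho_apply, Complex.ofReal_one, one_smul]

end Rows

/-! ### The row augmentation by `A^{0,•}(L)` and its exactness -/

section RowAug

variable [FiniteDimensional ℂ E] [T2Space M] [IsManifold 𝓘(ℂ, E) ω M] [IsManifold 𝓘(ℝ, E) ∞ M]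

/-- **The row augmentation** of the twisted Čech–Dolbeault complex by the global `L`-valued
Dolbeault complex `(A^{0,•}(L), ∂̄_L)`: `(ε α)_{(k)} = α_{frame k}|_{V_k}`.
[cite: VoisinHodgeI2002, Prop. 4.36 (proof)] -/
def twistDolbeaultRow : (C.twistDolbeault).RowAugmentation (fun b ↦ ↥(L.TwForms b)) where
  dA b := TwForms.dbar L b
  ε b :=
    { toFun := fun α J ↦ pqRestrict E M (isOpen_cechSet C.isOpen J) (C.cechSet_subset_baseSet J 0) 0 b
        (TwForms.comp α (C.frame (J 0)))
      map_add' := fun α β ↦ by funext J; rw [Pi.add_apply, ← map_add]; rfl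
      map_smul' := fun c α ↦ by funext J; rw [Pi.smul_apply, RingHom.id_apply, ← map_smul]; rfl }
  ε_dA b α := by
    funext J
    change pqRestrict E M (isOpen_cechSet C.isOpen J) (C.cechSet_subset_baseSet J 0) 0 (b + 1)
        (TwForms.comp (TwForms.dbar L b α) (C.frame (J 0))) =
      cechDbar E M C.isOpen 0 0 b (fun J ↦ pqRestrict E M (isOpen_cechSet C.isOpen J)
        (C.cechSet_subset_baseSet J 0) 0 b (TwForms.comp α (C.frame (J 0)))) J
    rw [cechDbar_apply, pow_zero, one_smul, localDbar_pqRestrict, TwForms.comp_dbar]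
  δ_ε b α := by
    funext J
    change C.twistδ 0 b (fun J ↦ pqRestrict E M (isOpen_cechSet C.isOpen J)
      (C.cechSet_subset_baseSet J 0) 0 b (TwForms.comp α (C.frame (J 0)))) J = 0
    apply Subtype.ext
    funext y
    rw [ZeroMemClass.coe_zero, Pi.zero_apply]
    by_cases hy : y ∈ cechSet C.U J
    swap
    · exact (C.twistδ 0 b _ J).2.2.1 y hy
    have hy0 : y ∈ cechSet C.U (J ∘ Fin.succAbove (0 : Fin 2)) := cechSet_subset_comp C.U J _ hy
    have hy1 : y ∈ cechSet C.U (J ∘ Fin.succAbove (1 : Fin 2)) := cechSet_subset_comp C.U J _ hy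
    rw [C.coe_twistδ_apply_apply_of_mem _ hy, Fin.sum_univ_two]
    simp only [Fin.val_zero, pow_zero, one_smul, Fin.val_one, pow_one, neg_one_smul, coe_pqRestrict,
      TwForms.coe_comp, MForm.restr_apply_of_mem _ hy0, MForm.restr_apply_of_mem _ hy1,
      C.trans_eq_one J (Fin.succAbove_ne_zero_zero (one_ne_zero : (1 : Fin 2) ≠ 0)) hy]
    have h10 : (J ∘ Fin.succAbove (1 : Fin 2)) 0 = J 0 := by simp
    have h00 : (J ∘ Fin.succAbove (0 : Fin 2)) 0 = J 1 := by simp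
    have ht : C.trans J (Fin.succAbove (0 : Fin 2)) y = L.coordChange (C.frame (J 1)) (C.frame (J 0)) y := by
      unfold trans
      simp
    rw [ht, h10, h00, ← α.2.2 (C.frame (J 1)) (C.frame (J 0)) y
      ⟨C.cechSet_subset_baseSet J 1 hy, C.cechSet_subset_baseSet J 0 hy⟩, add_neg_cancel]

/-- The row augmentation on underlying forms. [folklore] -/
theorem coe_twistDolbeaultRow_ε {b : ℕ} (α : L.TwForms b) (J : Fin 1 → κ) :
    ((C.twistDolbeaultRow).ε b α J : MForm 𝓘(ℝ, E) M ℂ (0 + b)) =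
      ((α : ι → MForm 𝓘(ℝ, E) M ℂ (0 + b)) (C.frame (J 0))).restr (cechSet C.U J) :=
  rfl

variable [Fintype κ] (ρ : SmoothPartitionOfUnity κ 𝓘(ℝ, E) M univ) (hρ : ρ.IsSubordinate C.U)

omit [Fintype κ] [T2Space M] in
include hρ in
/-- The terms `ρ_k g_{frame k, i} ω_k` of the glued `L`-valued form are `(0,b)`-forms on `U_i`.
[cite: VoisinHodgeI2002, Prop. 4.36 (proof)] -/
theorem smul_glueTerm_mem_pqFormsOn {b : ℕ} (c : CechPQForms E M C.U 0 0 b) (i : ι) (k : κ) :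
    (ρ k : M → ℝ) • ((L.coordChange (C.frame k) i) • (c (fun _ ↦ k) : MForm 𝓘(ℝ, E) M ℂ (0 + b))).restr
      (C.U k ∩ L.baseSet i) ∈ pqFormsOn E M (L.baseSet i) 0 b := by
  have hg : MDifferentiableOn 𝓘(ℂ, E) 𝓘(ℂ, ℂ) (L.coordChange (C.frame k) i) (C.U k ∩ L.baseSet i) :=
    (L.mdifferentiableOn_coordChange (C.frame k) i).mono fun x hx ↦ Set.mem_inter (C.subset k hx.1) hx.2
  have hck : (c (fun _ ↦ k) : MForm 𝓘(ℝ, E) M ℂ (0 + b)) ∈ smoothFormsOn 𝓘(ℝ, E) ℂ (C.U k) (0 + b) := by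
    rw [show C.U k = cechSet C.U (fun _ : Fin 1 ↦ k) from (cechSet_fin_one C.U (fun _ : Fin 1 ↦ k)).symm]
    exact mem_smoothFormsOn_of_mem_pqFormsOn (c (fun _ ↦ k)).2
  have h1 := fun_smul_restr_mem_smoothFormsOn ((C.isOpen k).inter (L.isOpen_baseSet i))
    inter_subset_left hg hck
  have h := fun_smul_mem_smoothFormsOn_of_tsupport_subset (ρ k).contMDiff (hρ k) (W := L.baseSet i) h1
  exact ⟨h.1, h.2, (((c _).2.2.2.cmul _).restr _).fun_smul _⟩

include hρ in
/-- **Exactness of the augmented rows at the column `0`**: `ε` is injective because `𝔙` covers `M`,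
and a twisted `δ`-cocycle `(ω_k)` glues to the `L`-valued form `α_i = Σ_k ρ_k g_{frame k, i} ω_k`
(Voisin I, proof of Prop. 4.36; Bott–Tu, Prop. 8.5 with the change of frame).
[cite: VoisinHodgeI2002, Prop. 4.36 (proof)] -/
theorem twistDolbeaultRow_exact (hcov : ∀ y : M, ∃ k, y ∈ C.U k) : (C.twistDolbeaultRow).Exact := by
  constructor
  · -- injectivity of `ε`
    intro b α β h
    apply Subtype.ext
    funext i
    funext y
    by_cases hyi : y ∈ L.baseSet i
    swap
    · rw [(α.2.1 i).2.1 y hyi, (β.2.1 i).2.1 y hyi]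
    obtain ⟨k, hyk⟩ := hcov y
    have hyU : y ∈ cechSet C.U (fun _ : Fin 1 ↦ k) := by
      rw [cechSet_fin_one]
      exact hyk
    have h' := congrArg (fun c : CechPQForms E M C.U 0 0 b ↦ (c (fun _ ↦ k) : MForm 𝓘(ℝ, E) M ℂ (0 + b)) y) h
    simp only [coe_twistDolbeaultRow_ε] at h'
    rw [MForm.restr_apply_of_mem _ hyU, MForm.restr_apply_of_mem _ hyU] at h'
    have hb : y ∈ L.baseSet (C.frame k) ∩ L.baseSet i := ⟨C.subset k hyk, hyi⟩
    rw [α.2.2 (C.frame k) i y hb, β.2.2 (C.frame k) i y hb, h']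
  · -- `ker δ₀ ⊆ im ε`
    intro b c hc
    have hmem : (fun i ↦ ∑ k, (ρ k : M → ℝ) • ((L.coordChange (C.frame k) i) •
        (c (fun _ ↦ k) : MForm 𝓘(ℝ, E) M ℂ (0 + b))).restr (C.U k ∩ L.baseSet i)) ∈ L.TwForms b := by
      refine ⟨fun i ↦ Submodule.sum_mem _ fun k _ ↦ C.smul_glueTerm_mem_pqFormsOn ρ hρ c i k,
        fun i j x hx ↦ ?_⟩
      simp only [Finset.sum_apply, Pi.smul_apply', Finset.smul_sum]
      refine Finset.sum_congr rfl fun k _ ↦ ?_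
      by_cases hxk : x ∈ C.U k
      · rw [MForm.restr_apply_of_mem _ (Set.mem_inter hxk hx.2), MForm.restr_apply_of_mem _ (Set.mem_inter hxk hx.1),
          MForm.fun_smul_complex_apply, MForm.fun_smul_complex_apply, smul_comm (L.coordChange i j x),
          smul_smul, mul_comm, L.coordChange_comp _ _ _ x ⟨⟨C.subset k hxk, hx.1⟩, hx.2⟩]
      · rw [rho_apply_eq_zero ρ hρ hxk, zero_smul, zero_smul, smul_zero]
    refine ⟨⟨_, hmem⟩, ?_⟩
    funext J
    apply Subtype.ext
    rw [coe_twistDolbeaultRow_ε]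
    funext y
    by_cases hy : y ∈ cechSet C.U J
    · have hy0 : y ∈ C.U (J 0) := cechSet_subset_apply C.U J 0 hy
      have hJ : J = fun _ ↦ J 0 := by
        funext i
        rw [Fin.fin_one_eq_zero i]
      rw [MForm.restr_apply_of_mem _ hy]
      change (∑ k, (ρ k : M → ℝ) • ((L.coordChange (C.frame k) (C.frame (J 0))) •
        (c (fun _ ↦ k) : MForm 𝓘(ℝ, E) M ℂ (0 + b))).restr (C.U k ∩ L.baseSet (C.frame (J 0)))) y = _
      simp only [Finset.sum_apply, Pi.smul_apply']
      calc ∑ k, ρ k y • (((L.coordChange (C.frame k) (C.frame (J 0))) •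
              (c (fun _ ↦ k) : MForm 𝓘(ℝ, E) M ℂ (0 + b))).restr (C.U k ∩ L.baseSet (C.frame (J 0)))) y
          = ∑ k, ρ k y • (c (fun _ ↦ J 0) : MForm 𝓘(ℝ, E) M ℂ (0 + b)) y := by
            refine Finset.sum_congr rfl fun k _ ↦ ?_
            by_cases hyk : y ∈ C.U k
            · rw [MForm.restr_apply_of_mem _ (Set.mem_inter hyk (C.subset _ hy0)), MForm.fun_smul_complex_apply,
                ← C.apply_eq_smul_of_twistδ_zero_eq_zero hc (J 0) k hy0 hyk]
            · rw [rho_apply_eq_zero ρ hρ hyk, zero_smul, zero_smul]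
        _ = (c J : MForm 𝓘(ℝ, E) M ℂ (0 + b)) y := by
            rw [← Finset.sum_smul, sum_rho_apply, one_smul, ← hJ]
    · rw [MForm.restr_apply_of_notMem _ hy, (c J).2.2.1 y hy]

end RowAug

/-! ### The column augmentation by the holomorphic cochains `C^a(𝔙, 𝒪(L))` -/

section ColAug

variable [FiniteDimensional ℂ E] [T2Space M] [IsManifold 𝓘(ℂ, E) ω M] [IsManifold 𝓘(ℝ, E) ∞ M]

omit [T2Space M] in
/-- **A holomorphic function on an open `W` as a `(0,0)`-form on `W`** (its `0`-form
`MForm.ofFun`, cut off to `W`). [cite: VoisinHodgeI2002, §2.3.3] -/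
def holToForm {W : Set M} (hW : IsOpen W) : ↥(holFunOn E W) →ₗ[ℂ] ↥(pqFormsOn E M W 0 0) where
  toFun f := ⟨(MForm.ofFun 𝓘(ℝ, E) (f : M → ℂ)).restr W, restr_ofFun_mem_pqFormsOn hW fun y hy ↦
    contMDiffAt_real_of_mdifferentiableOn_complex (holFunOn.mdifferentiableOn f) hW hy⟩
  map_add' f g := by
    refine Subtype.ext ?_
    change (MForm.ofFun 𝓘(ℝ, E) ((f : M → ℂ) + (g : M → ℂ))).restr W = _
    rw [MForm.ofFun_add, MForm.restr_add]
    rfl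
  map_smul' c f := by
    refine Subtype.ext ?_
    change (MForm.ofFun 𝓘(ℝ, E) (c • (f : M → ℂ))).restr W = c • (MForm.ofFun 𝓘(ℝ, E) (f : M → ℂ)).restr W
    rw [← MForm.restr_smul_complex]
    rfl

omit [T2Space M] in
/-- `holToForm` at a point of `W`, evaluated: the value of the function. [folklore] -/
theorem holToForm_apply_apply_of_mem {W : Set M} (hW : IsOpen W) (f : ↥(holFunOn E W)) {y : M} (hy : y ∈ W)
    (v : Fin 0 → TangentSpace 𝓘(ℝ, E) y) :
    (holToForm hW f : MForm 𝓘(ℝ, E) M ℂ (0 + 0)) y v = (f : M → ℂ) y := by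
  change ((MForm.ofFun 𝓘(ℝ, E) (f : M → ℂ)).restr W) y v = _
  rw [MForm.restr_apply_of_mem _ hy, MForm.ofFun_apply]

omit [T2Space M] in
/-- `holToForm` off `W`. [folklore] -/
theorem holToForm_apply_of_notMem {W : Set M} (hW : IsOpen W) (f : ↥(holFunOn E W)) {y : M} (hy : y ∉ W) :
    (holToForm hW f : MForm 𝓘(ℝ, E) M ℂ (0 + 0)) y = 0 :=
  MForm.restr_apply_of_notMem _ hy

/-- **Holomorphic functions are `∂̄`-closed**: `∂̄_W (holToForm f) = 0`. [cite: VoisinHodgeI2002, §2.3.3 Lemma 2.29] -/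
theorem localDbar_holToForm {W : Set M} (hW : IsOpen W) (f : ↥(holFunOn E W)) :
    localDbar E M hW 0 0 (holToForm hW f) = 0 := by
  refine Subtype.ext (funext fun y ↦ ?_)
  rw [ZeroMemClass.coe_zero, Pi.zero_apply]
  by_cases hy : y ∈ W
  · rw [localDbar_apply_of_mem _ _ hy]
    change dolbeaultBar ((MForm.ofFun 𝓘(ℝ, E) (f : M → ℂ)).restr W) y = 0
    rw [dolbeaultBar_restr_apply_of_mem hW _ hy]
    exact dolbeaultBar_ofFun_eq_zero_of_mdifferentiableOn hW (holFunOn.mdifferentiableOn f) hy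
  · exact (localDbar E M hW 0 0 _).2.2.1 y hy

/-- **The column augmentation** of the twisted Čech–Dolbeault complex by the Čech complex
`C^•(𝔙, 𝒪(L))` of holomorphic cochains (`HolomorphicLineBundleCech`): a holomorphic function is a
`∂̄`-closed `(0,0)`-form, and the two Čech differentials have the same formula.
[cite: VoisinHodgeI2002, Thm. 4.41 (proof)] -/
def twistDolbeaultCol : (C.twistDolbeault).ColAugmentation (fun a ↦ C.Cochain a) where
  dA a := C.delta a
  ε a :=
    { toFun := fun c J ↦ holToForm (isOpen_cechSet C.isOpen J) (c J)
      map_add' := fun c c' ↦ by funext J; simp only [Pi.add_apply, map_add]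
      map_smul' := fun r c ↦ by funext J; simp only [Pi.smul_apply, map_smul, RingHom.id_apply] }
  ε_dA a c := by
    funext J
    change holToForm (isOpen_cechSet C.isOpen J) (C.delta a c J) =
      C.twistδ a 0 (fun J ↦ holToForm (isOpen_cechSet C.isOpen J) (c J)) J
    apply Subtype.ext
    funext y
    by_cases hy : y ∈ cechSet C.U J
    · rw [C.coe_twistδ_apply_apply_of_mem _ hy]
      ext v
      rw [holToForm_apply_apply_of_mem _ _ hy, C.delta_apply_apply_of_mem c hy,
        ContinuousAlternatingMap.sum_apply]
      refine Finset.sum_congr rfl fun j _ ↦ ?_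
      rw [ContinuousAlternatingMap.smul_apply, ContinuousAlternatingMap.smul_apply,
        holToForm_apply_apply_of_mem _ _ (cechSet_subset_comp C.U J _ hy), smul_eq_mul, smul_eq_mul]
    · rw [holToForm_apply_of_notMem _ _ hy, C.coe_twistδ_apply_apply_of_notMem _ hy]
  δ_ε a c := by
    funext J
    change (-1 : ℂ) ^ a • localDbar E M (isOpen_cechSet C.isOpen J) 0 0 (holToForm (isOpen_cechSet C.isOpen J) (c J)) = 0
    rw [localDbar_holToForm, smul_zero]

/-- **Exactness of the augmented columns at the row `0`**: a `(0,0)`-form cochain killed by `∂̄`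
is the cochain of the holomorphic functions `y ↦ ω_J(y)` (`∂̄`-closed functions are holomorphic,
Cauchy–Riemann). [cite: VoisinHodgeI2002, §2.3.3 Lemma 2.29] -/
theorem twistDolbeaultCol_exact : (C.twistDolbeaultCol).Exact := by
  constructor
  · intro a g g' h
    funext J
    refine Subtype.ext (funext fun y ↦ ?_)
    by_cases hy : y ∈ cechSet C.U J
    · have h' := congrArg (fun c : CechPQForms E M C.U 0 a 0 ↦ (c J : MForm 𝓘(ℝ, E) M ℂ (0 + 0)) y ![]) h
      change (holToForm (isOpen_cechSet C.isOpen J) (g J) : MForm 𝓘(ℝ, E) M ℂ (0 + 0)) y ![] =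
        (holToForm (isOpen_cechSet C.isOpen J) (g' J) : MForm 𝓘(ℝ, E) M ℂ (0 + 0)) y ![] at h'
      rwa [holToForm_apply_apply_of_mem _ _ hy, holToForm_apply_apply_of_mem _ _ hy] at h'
    · rw [holFunOn.apply_of_notMem _ hy, holFunOn.apply_of_notMem _ hy]
  · intro a c hc
    -- `∂̄ ω_J = 0` on `V_J`
    have hcl : ∀ J, localDbar E M (isOpen_cechSet C.isOpen J) 0 0 (c J) = 0 := fun J ↦ by
      have h := congrFun hc J
      change cechDbar E M C.isOpen 0 a 0 c J = 0 at h
      rw [cechDbar_apply] at h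
      exact (smul_eq_zero_iff_right (pow_ne_zero _ (by norm_num))).1 h
    -- the functions `y ↦ ω_J(y)` are holomorphic on `V_J`
    have hofFun : ∀ J, MForm.ofFun 𝓘(ℝ, E) (fun y ↦ (c J : MForm 𝓘(ℝ, E) M ℂ (0 + 0)) y ![]) =
        (c J : MForm 𝓘(ℝ, E) M ℂ (0 + 0)) := fun J ↦ MForm.ofFun_apply_vecEmpty _
    have hhol : ∀ J, MDifferentiableOn 𝓘(ℂ, E) 𝓘(ℂ, ℂ) (fun y ↦ (c J : MForm 𝓘(ℝ, E) M ℂ (0 + 0)) y ![])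
        (cechSet C.U J) := fun J ↦ by
      refine mdifferentiableOn_of_dolbeaultBar_ofFun_eq_zero (fun x hx ↦ ?_) (fun x hx ↦ ?_)
      · rw [hofFun J]
        exact (c J).2.1 x hx
      · rw [hofFun J, ← localDbar_apply_of_mem (isOpen_cechSet C.isOpen J) (c J) hx, hcl J]
        rfl
    refine ⟨fun J ↦ ⟨fun y ↦ (c J : MForm 𝓘(ℝ, E) M ℂ (0 + 0)) y ![], hhol J, fun y hy ↦ by
      simp only [(c J).2.2.1 y hy]; rfl⟩, ?_⟩
    funext J
    change holToForm (isOpen_cechSet C.isOpen J) _ = c J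
    refine Subtype.ext ?_
    change (MForm.ofFun 𝓘(ℝ, E) (fun y ↦ (c J : MForm 𝓘(ℝ, E) M ℂ (0 + 0)) y ![])).restr (cechSet C.U J) = _
    rw [hofFun J, restr_eq_self_of_mem_pqFormsOn (c J).2]

/-- **Exactness of the columns in positive rows from `∂̄`-acyclicity** of the finite intersections
`V_J` (the `∂̄`-Poincaré lemma; Griffiths–Harris p. 45). [cite: GriffithsHarris1978, p. 45] -/
theorem twistDolbeault_colExact
    (hacyc : ∀ (a : ℕ) (J : Fin (a + 1) → κ), IsDolbeaultAcyclic E M (isOpen_cechSet C.isOpen J) 0) :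
    (C.twistDolbeault).ColExact := by
  refine ⟨fun a b c hc ↦ ?_⟩
  have hex : ∀ J, ∃ β : ↥(pqFormsOn E M (cechSet C.U J) 0 b),
      localDbar E M (isOpen_cechSet C.isOpen J) 0 b β = c J := fun J ↦ by
    apply hacyc a J b (c J)
    have h := congrFun hc J
    change cechDbar E M C.isOpen 0 a (b + 1) c J = 0 at h
    rw [cechDbar_apply] at h
    exact (smul_eq_zero_iff_right (pow_ne_zero _ (by norm_num))).1 h
  choose β hβ using hex
  refine ⟨fun J ↦ (-1 : ℂ) ^ a • β J, ?_⟩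
  funext J
  change cechDbar E M C.isOpen 0 a b (fun J ↦ (-1 : ℂ) ^ a • β J) J = c J
  rw [cechDbar_apply, map_smul, smul_smul, ← pow_add, ← two_mul, pow_mul, neg_one_sq, one_pow, one_smul]
  exact hβ J

end ColAug

/-! ### The comparison `H^q(A^{0,•}(L), ∂̄_L) ≅ Ȟ^q(𝔙, 𝒪(L))` -/

section Equiv

variable [FiniteDimensional ℂ E] [T2Space M] [IsManifold 𝓘(ℂ, E) ω M] [IsManifold 𝓘(ℝ, E) ∞ M]

/-- **Leray's theorem for `𝒪(L)` and a finite `∂̄`-acyclic framed cover**: for a cocycle line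
bundle `L` on a Hausdorff σ-compact complex manifold and a finite framed cover `𝔙` of `M` all of
whose finite intersections `V_J` are `∂̄`-acyclic in bidegrees `(0, ≥ 1)`, the cohomology of the
global twisted Dolbeault complex `(A^{0,•}(L), ∂̄_L)` is isomorphic in EVERY degree to the Čech
cohomology `Ȟ^q(𝔙, 𝒪(L))` of `HolomorphicLineBundleCech` (both are the total cohomology of the
twisted Čech–Dolbeault double complex). Voisin I, Thm. 4.41 with Prop. 4.36 / Cor. 4.38;
Griffiths–Harris pp. 40–45. [cite: VoisinHodgeI2002, Thm. 4.41] -/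
def cechDolbeaultEquivL [SigmaCompactSpace M] [Fintype κ] (hcov : ⋃ k, C.U k = univ)
    (hacyc : ∀ (a : ℕ) (J : Fin (a + 1) → κ), IsDolbeaultAcyclic E M (isOpen_cechSet C.isOpen J) 0) (q : ℕ) :
    NatCochain.Cohomology (R := ℂ) (fun b ↦ TwForms.dbar L b) q ≃ₗ[ℂ] C.cohomology q :=
  have hρ := (SmoothPartitionOfUnity.exists_isSubordinate 𝓘(ℝ, E) isClosed_univ C.U C.isOpen
    hcov.symm.subset).choose_spec
  ADoubleComplex.rowColEquiv C.twistDolbeaultRow C.twistDolbeaultCol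
    (C.twistDolbeault_rowExact _ hρ)
    (C.twistDolbeaultRow_exact _ hρ fun y ↦ mem_iUnion.1 (hcov.symm.subset (mem_univ y)))
    (C.twistDolbeault_colExact hacyc) C.twistDolbeaultCol_exact q

end Equiv

/-! ### Naturality under shrinking of the cover -/

section Shrink

variable [FiniteDimensional ℂ E] [T2Space M] [IsManifold 𝓘(ℂ, E) ω M] [IsManifold 𝓘(ℝ, E) ∞ M]
  (U' : κ → Set M) (hU' : ∀ k, IsOpen (U' k)) (hsub : ∀ k, U' k ⊆ C.U k)

/-- **Restriction of the twisted Čech–Dolbeault complex to a shrunk cover** `V'_k ⊆ V_k` (same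
frames), a morphism of double complexes. [cite: BottTu1982Forms, §8] -/
def twistDolbeaultShrink : (C.twistDolbeault).Hom ((C.shrink U' hU' hsub).twistDolbeault) where
  f a b :=
    { toFun := fun c J ↦ pqRestrict E M (isOpen_cechSet hU' J) (cechSet_mono hsub J) 0 b (c J)
      map_add' := fun c c' ↦ by funext J; exact map_add _ (c J) (c' J)
      map_smul' := fun r c ↦ by funext J; exact map_smul _ r (c J) }
  f_d a b c := by
    funext J
    change pqRestrict E M (isOpen_cechSet hU' J) (cechSet_mono hsub J) 0 (b + 1) (cechDbar E M C.isOpen 0 a b c J) =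
      cechDbar E M hU' 0 a b (fun J ↦ pqRestrict E M (isOpen_cechSet hU' J) (cechSet_mono hsub J) 0 b (c J)) J
    rw [cechDbar_apply, cechDbar_apply, map_smul, localDbar_pqRestrict]
  f_δ a b c := by
    funext J
    apply Subtype.ext
    change ((C.twistδ a b c J : MForm 𝓘(ℝ, E) M ℂ (0 + b))).restr (cechSet U' J) =
      ((C.shrink U' hU' hsub).twistδ a b
        (fun J ↦ pqRestrict E M (isOpen_cechSet hU' J) (cechSet_mono hsub J) 0 b (c J)) J : MForm 𝓘(ℝ, E) M ℂ (0 + b))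
    funext y
    by_cases hy : y ∈ cechSet U' J
    · rw [MForm.restr_apply_of_mem _ hy, C.coe_twistδ_apply_apply_of_mem _ (cechSet_mono hsub J hy),
        (C.shrink U' hU' hsub).coe_twistδ_apply_apply_of_mem _ hy]
      refine Finset.sum_congr rfl fun j _ ↦ ?_
      rw [coe_pqRestrict, MForm.restr_apply_of_mem _ (cechSet_subset_comp U' J _ hy)]
      rfl
    · rw [MForm.restr_apply_of_notMem _ hy, (C.shrink U' hU' hsub).coe_twistδ_apply_apply_of_notMem _ hy]

/-- The identity of `A^{0,•}(L)` is a morphism of row augmentations over the shrinking morphism.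
[cite: BottTu1982Forms, §8] -/
def twistDolbeaultRowShrink :
    ADoubleComplex.RowAugmentation.Hom C.twistDolbeaultRow (C.shrink U' hU' hsub).twistDolbeaultRow
      (C.twistDolbeaultShrink U' hU' hsub) where
  g b := LinearMap.id
  g_dA _ _ := rfl
  ε_g b α := by
    funext J
    apply Subtype.ext
    change (((α : ι → MForm 𝓘(ℝ, E) M ℂ (0 + b)) (C.frame (J 0)))).restr (cechSet U' J) =
      ((((α : ι → MForm 𝓘(ℝ, E) M ℂ (0 + b)) (C.frame (J 0)))).restr (cechSet C.U J)).restr (cechSet U' J)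
    rw [MForm.restr_restr_of_subset (cechSet_mono hsub J)]

/-- Restriction of holomorphic cochains (`FramedCover.res`) is a morphism of column augmentations
over the shrinking morphism. [cite: GrauertRemmert1977, Kap. VI Einleitung] -/
def twistDolbeaultColShrink :
    ADoubleComplex.RowAugmentation.Hom C.twistDolbeaultCol (C.shrink U' hU' hsub).twistDolbeaultCol
      (C.twistDolbeaultShrink U' hU' hsub).swap where
  g a := C.res U' hU' hsub a
  g_dA a c := C.res_delta U' hU' hsub a c
  ε_g a c := by
    funext J
    apply Subtype.ext
    change ((MForm.ofFun 𝓘(ℝ, E) ((C.res U' hU' hsub a c J : ↥(holFunOn E _)) : M → ℂ))).restr (cechSet U' J) =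
      ((MForm.ofFun 𝓘(ℝ, E) ((c J : ↥(holFunOn E _)) : M → ℂ)).restr (cechSet C.U J)).restr (cechSet U' J)
    rw [MForm.restr_restr_of_subset (cechSet_mono hsub J)]
    funext y
    by_cases hy : y ∈ cechSet U' J
    · rw [MForm.restr_apply_of_mem _ hy, MForm.restr_apply_of_mem _ hy]
      ext v
      rw [MForm.ofFun_apply, MForm.ofFun_apply, C.res_apply_apply_of_mem U' hU' hsub _ hy]
    · rw [MForm.restr_apply_of_notMem _ hy, MForm.restr_apply_of_notMem _ hy]

/-- **Naturality of the twisted Čech–Dolbeault isomorphism under shrinking of the cover**: for two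
finite covering framed covers `𝔙' ≤ 𝔙` (`V'_k ⊆ V_k`, same frames) with `∂̄`-acyclic finite
intersections, `cechDolbeaultEquivL 𝔙' = H^q(res) ∘ cechDolbeaultEquivL 𝔙`; in particular the
restriction `Ȟ^q(𝔙, 𝒪(L)) → Ȟ^q(𝔙', 𝒪(L))` is an ISOMORPHISM (Grauert–Remmert (1977), Kap. VI,
Einleitung), the Leray input of the twisted Cartan–Serre theorem. [cite: GrauertRemmert1977, Kap. VI Einleitung] -/
theorem cechDolbeaultEquivL_natural [SigmaCompactSpace M] [Fintype κ] (hcov : ⋃ k, C.U k = univ)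
    (hcov' : ⋃ k, U' k = univ)
    (hacyc : ∀ (a : ℕ) (J : Fin (a + 1) → κ), IsDolbeaultAcyclic E M (isOpen_cechSet C.isOpen J) 0)
    (hacyc' : ∀ (a : ℕ) (J : Fin (a + 1) → κ), IsDolbeaultAcyclic E M (isOpen_cechSet hU' J) 0)
    (q : ℕ) (c : NatCochain.Cohomology (R := ℂ) (fun b ↦ TwForms.dbar L b) q) :
    (C.shrink U' hU' hsub).cechDolbeaultEquivL hcov' hacyc' q c =
      NatCochain.Cohomology.map (R := ℂ) (A := fun a ↦ C.Cochain a) (A' := fun a ↦ (C.shrink U' hU' hsub).Cochain a)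
        (C.res U' hU' hsub) (C.res_delta U' hU' hsub) q (C.cechDolbeaultEquivL hcov hacyc q c) := by
  have h := ADoubleComplex.rowColEquiv_natural (C.twistDolbeaultShrink U' hU' hsub)
    (C.twistDolbeaultRowShrink U' hU' hsub) (C.twistDolbeaultColShrink U' hU' hsub)
    (C.twistDolbeault_rowExact _ (SmoothPartitionOfUnity.exists_isSubordinate 𝓘(ℝ, E) isClosed_univ C.U C.isOpen
      hcov.symm.subset).choose_spec)
    (C.twistDolbeaultRow_exact _ (SmoothPartitionOfUnity.exists_isSubordinate 𝓘(ℝ, E) isClosed_univ C.U C.isOpen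
      hcov.symm.subset).choose_spec fun y ↦ mem_iUnion.1 (hcov.symm.subset (mem_univ y)))
    (C.twistDolbeault_colExact hacyc) C.twistDolbeaultCol_exact
    ((C.shrink U' hU' hsub).twistDolbeault_rowExact _ (SmoothPartitionOfUnity.exists_isSubordinate 𝓘(ℝ, E)
      isClosed_univ U' hU' hcov'.symm.subset).choose_spec)
    ((C.shrink U' hU' hsub).twistDolbeaultRow_exact _ (SmoothPartitionOfUnity.exists_isSubordinate 𝓘(ℝ, E)
      isClosed_univ U' hU' hcov'.symm.subset).choose_spec fun y ↦ mem_iUnion.1 (hcov'.symm.subset (mem_univ y)))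
    ((C.shrink U' hU' hsub).twistDolbeault_colExact hacyc') (C.shrink U' hU' hsub).twistDolbeaultCol_exact q c
  have hid : (C.twistDolbeaultRowShrink U' hU' hsub).cohMap q c = c :=
    NatCochain.Cohomology.map_id_apply _ q c
  rw [hid] at h
  exact h

end Shrink

end FramedCover

end HolomorphicLineBundle

end Literature.Geometry.Kaehler

end
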